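import Summits.NavierStokesRegularity.NavierStokesRegularity.Theorems.SoloRefuteTarver2016ClaySwirl
import Summits.NavierStokesRegularity.NavierStokesRegularity.Theorems.SoloRefuteTarver2016
import HarnessLib

/-!
# Tarver (2016), C80 — file 3/3: the consumed Clay-grain Step 3 `WaveGivesNS` is false (kernel)

Claim file: `Literature.Claims.NS.Tarver2016` (row C80 of cell `ns-claims`, ADJUDICATED #86 on
`…Theorems.Tarver2016.not_WaveGivesNSAbs` — the abstract-grain twin, shear datum outside Clay's class
(4)). This module decides the CONSUMED step `Literature.Claims.NS.Tarver2016.WaveGivesNS` (pp.5–7: «we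
have the solution to the three-dimensional simple wave equation where u⃗ = φ and u⃗ₜ = ψ initially …
Since the pressure p is being eliminated and the stream function exists, the velocity u⃗ exists»), whose
datum is of Clay's class (4). Kit by ns-claims-typist-1 g3 (idle-typist KIT POOL duty); the refuter of
record adopts, the salvage seat files; ADDENDUM-grade to #86.

* `not_WaveGivesNS : ¬ WaveGivesNS` (unconditional). The vector wave `U = −½ J ∇W` of
  `…SoloRefuteTarver2016ClaySwirl` is a smooth global solution of `∂ₜ²U = ΔU` on `ℝ³ × [0,∞)` issued
  from the class-(4) datum `u₀ = e^{−|x|²} J x` with `∂ₜU(0) = 0`. Step 3 would hand it a smooth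
  pressure `p` with `(U, p)` solving (1)–(3); the momentum equation at `t = 0` then reads
  `∇p(0,·) = Δu₀ − (u₀·∇)u₀ = (4|x|² − 10)e^{−|x|²} Jx − e^{−2|x|²} J(Jx)`, whose pairing with `γ′ = Jγ`
  along the unit circle `γ(s) = (cos s, sin s, 0)` is the constant `−6/e`; a gradient has zero
  circulation (`no_potential_of_circulation`, first derivatives of `p` only) — `obstruction`.
* `not_waveCauchy_and_waveGivesNS : ¬ (WaveCauchy ∧ WaveGivesNS)`: the same obstruction with the wave
  solution taken from the paper's own Step 2 (Poisson–Kirchhoff) — the two steps consumed by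
  `Literature.Claims.NS.Tarver2016.claim_of_steps` are jointly inconsistent.

All calculus is folklore; nothing here is specific to the author beyond the typed locator.

WHAT THIS IS NOT: not a statement about the Navier–Stokes problem itself; not about any author beyond
the typed locator.
-/

noncomputable section

open Set Filter Topology InnerProductSpace Function
open Literature.Analysis.FluidPDE Literature.Analysis.FunctionSpaces Literature.Claims.NS.Tarver2016
open scoped RealInnerProductSpace Laplacian ContDiff SchwartzMap

-- The summit's canonical theorem namespace repeats the summit name (single-conjunct summit).
set_option linter.dupNamespace false

namespace Summit.NavierStokesRegularity.NavierStokesRegularity.Theorems.Tarver2016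

/-- Local notation for physical space. -/
local notation "ℝ³" => EuclideanSpace ℝ (Fin 3)

/-! ## The unit circle in the plane `x₂ = 0` and the circulation obstruction -/

/-- The unit circle `γ(s) = (cos s, sin s, 0)`. [folklore] -/
def circ (s : ℝ) : ℝ³ :=
  Real.cos s • EuclideanSpace.single 0 (1 : ℝ) + Real.sin s • EuclideanSpace.single 1 (1 : ℝ)

/-- `γ(s)₀ = cos s`. [folklore] -/
@[simp] theorem circ_apply_zero (s : ℝ) : circ s 0 = Real.cos s := by simp [circ]

/-- `γ(s)₁ = sin s`. [folklore] -/
@[simp] theorem circ_apply_one (s : ℝ) : circ s 1 = Real.sin s := by simp [circ]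

/-- `γ(s)₂ = 0`. [folklore] -/
@[simp] theorem circ_apply_two (s : ℝ) : circ s 2 = 0 := by simp [circ]

/-- `|γ(s)|² = 1`. [folklore] -/
theorem norm_circ_sq (s : ℝ) : ‖circ s‖ ^ 2 = 1 := by
  rw [EuclideanSpace.real_norm_sq_eq, Fin.sum_univ_three, circ_apply_zero, circ_apply_one,
    circ_apply_two]
  nlinarith [Real.cos_sq_add_sin_sq s]

/-- `γ'(s) = J γ(s)`. [folklore] -/
theorem hasDerivAt_circ (s : ℝ) : HasDerivAt circ (rotGen (circ s)) s := by
  have h := ((Real.hasDerivAt_cos s).smul_const (EuclideanSpace.single (0 : Fin 3) (1 : ℝ))).add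
    ((Real.hasDerivAt_sin s).smul_const (EuclideanSpace.single (1 : Fin 3) (1 : ℝ)))
  have e : rotGen (circ s) =
      (-Real.sin s) • EuclideanSpace.single (0 : Fin 3) (1 : ℝ) +
        Real.cos s • EuclideanSpace.single (1 : Fin 3) (1 : ℝ) := by
    ext i
    fin_cases i <;> simp [circ, rotGen]
  rw [e]
  exact h

/-- The circle closes up: `γ(2π) = γ(0)`. [folklore] -/
theorem circ_two_pi : circ (2 * Real.pi) = circ 0 := by
  simp [circ]

/-- `⟪Jγ, Jγ⟫ = 1` on the unit circle. [folklore] -/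
theorem inner_rotGen_circ (s : ℝ) : ⟪rotGen (circ s), rotGen (circ s)⟫ = 1 := by
  rw [inner_rotGen_rotGen, circ_apply_zero, circ_apply_one]
  nlinarith [Real.cos_sq_add_sin_sq s]

/-- **A gradient has zero circulation**: no differentiable `Q : ℝ³ → ℝ` has
`⟪∇Q(γ(s)), γ'(s)⟫ = K ≠ 0` all along the closed unit circle. [folklore] -/
theorem no_potential_of_circulation {Q : ℝ³ → ℝ} (hQ : Differentiable ℝ Q) {K : ℝ} (hK : K ≠ 0)
    (h : ∀ s : ℝ, ⟪gradient Q (circ s), rotGen (circ s)⟫ = K) : False := by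
  have hd : ∀ s, HasDerivAt (fun r => Q (circ r)) K s := fun s => by
    have h1 : HasDerivAt (fun r => Q (circ r)) (fderiv ℝ Q (circ s) (rotGen (circ s))) s :=
      (hQ (circ s)).hasFDerivAt.comp_hasDerivAt s (hasDerivAt_circ s)
    rw [← inner_gradient_left, h s] at h1
    exact h1
  have hsub : ∀ r, HasDerivAt (fun r => Q (circ r) - K * r) (K - K * 1) r := fun r =>
    (hd r).sub ((hasDerivAt_id r).const_mul K)
  have hdiff : Differentiable ℝ fun r => Q (circ r) - K * r := fun r => (hsub r).differentiableAt
  have hzero : ∀ r, deriv (fun r => Q (circ r) - K * r) r = 0 := fun r => by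
    rw [(hsub r).deriv]
    ring
  have hc := is_const_of_deriv_eq_zero hdiff hzero (2 * Real.pi) 0
  simp only [circ_two_pi, mul_zero, sub_zero] at hc
  have hK0 : K * (2 * Real.pi) = 0 := by linarith
  rcases mul_eq_zero.mp hK0 with h0 | h0
  · exact hK h0
  · linarith [Real.pi_pos]

/-! ## The obstruction at `t = 0` -/

/-- **The momentum equation at `t = 0` is not solvable for the Gaussian swirl with `∂ₜU(0) = 0`.**
If `(U, p)` solves (1)–(3) (`ν = 1`, `f ≡ 0`) from `u₀`, `p` is smooth on the half-space and
`∂ₜU(·, 0) = 0`, then `∇p(0, ·) = Δu₀ − (u₀·∇)u₀`, whose circulation around the unit circle is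
`2π · (−6/e) ≠ 0`. [folklore] -/
theorem obstruction {U : ℝ → ℝ³ → ℝ³} {p : ℝ → ℝ³ → ℝ} (hp : IsSmoothOnHalfSpace p)
    (hns : IsNavierStokesSolution 1 0 swirl0 U p) (hU0 : U 0 = swirl0)
    (hUt : ∀ x : ℝ³, derivWithin (fun s => U s x) (Ici 0) 0 = 0) : False := by
  have hQ : Differentiable ℝ (p 0) := differentiable_slice hp le_rfl
  have hK : (-6 * Real.exp (-1) : ℝ) ≠ 0 := by positivity
  refine no_potential_of_circulation hQ hK fun s => ?_
  have hmom := hns.momentum 0 le_rfl (circ s)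
  rw [hUt, hU0, convect_swirl0, laplacian_swirl0] at hmom
  have hgrad : gradient (p 0) (circ s) =
      ((4 * ‖circ s‖ ^ 2 - 10) * Real.exp (-‖circ s‖ ^ 2)) • rotGen (circ s) -
        (gauss (circ s) * gauss (circ s)) • rotGen (rotGen (circ s)) := by
    have h' := hmom
    simp only [Pi.zero_apply, add_zero, one_smul, zero_add] at h'
    rw [h', sub_sub_cancel]
  rw [hgrad, inner_sub_left, real_inner_smul_left, real_inner_smul_left, inner_rotGen_circ,
    inner_rotGen_self, norm_circ_sq]
  ring

/-! ## STAGE 1: Steps 2 and 3 are jointly inconsistent at the Clay grain -/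

/-- **KILL (Clay grain, conditional form): `¬ (WaveCauchy ∧ WaveGivesNS)`.** The two steps consumed by
`Literature.Claims.NS.Tarver2016.claim_of_steps` cannot both hold: Step 2 issues a smooth global wave
solution `U` from the class-(4) datum `u₀ = e^{−|x|²} J x` with `∂ₜU(0) = 0`; Step 3 would make it a
Navier–Stokes velocity, and the momentum equation at `t = 0` is then contradictory (`obstruction`). -/
theorem not_waveCauchy_and_waveGivesNS :
    ¬ (Literature.Claims.NS.Tarver2016.WaveCauchy ∧ Literature.Claims.NS.Tarver2016.WaveGivesNS) := by
  rintro ⟨h2, h3⟩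
  obtain ⟨U, hU, hwave, h0, h1⟩ :=
    h2 1 swirl0 (fun _ => 0) one_pos contDiff_swirl0 contDiff_const
  have h1' : ∀ x : ℝ³, derivWithin (fun s => U s x) (Ici 0) 0 = 0 := fun x => by
    simpa using h1 x
  obtain ⟨p, hp, hns, -⟩ := h3 1 swirl0 U one_pos contDiff_swirl0 isDivFree_swirl0
    hasRapidSpatialDecay_swirl0 hU hwave h0 h1'
  exact obstruction hp hns h0 h1'

/-- Step 2 (classical: Poisson–Kirchhoff) refutes Step 3 at the Clay grain. -/
theorem not_waveGivesNS_of_waveCauchy (h : Literature.Claims.NS.Tarver2016.WaveCauchy) :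
    ¬ Literature.Claims.NS.Tarver2016.WaveGivesNS :=
  fun h' => not_waveCauchy_and_waveGivesNS ⟨h, h'⟩

/-! ## STAGE 2: `¬ WaveGivesNS` -/

/-- **KILL (Clay grain, unconditional): `¬ WaveGivesNS`.** The vector wave `U = −½ J ∇W` built on the
Gaussian spherical wave `W` is a smooth global solution of `∂ₜ²U = ΔU` on `ℝ³ × [0, ∞)` issued from the
class-(4) datum `u₀ = e^{−|x|²} J x` with `∂ₜU(0) = 0`; Step 3 would hand it a smooth pressure making
`(U, p)` a Navier–Stokes solution, and the momentum equation at `t = 0` is contradictory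
(`obstruction`: `Δu₀ − (u₀·∇)u₀` has circulation `−12π/e ≠ 0` around the unit circle). -/
theorem not_WaveGivesNS : ¬ Literature.Claims.NS.Tarver2016.WaveGivesNS := by
  intro h
  obtain ⟨p, hp, hns, -⟩ := h 1 swirl0 Uvec one_pos contDiff_swirl0 isDivFree_swirl0
    hasRapidSpatialDecay_swirl0 Uvec_smooth Uvec_isWaveSolution Uvec_zero derivWithin_Uvec_zero
  exact obstruction hp hns Uvec_zero derivWithin_Uvec_zero

end Summit.NavierStokesRegularity.NavierStokesRegularity.Theorems.Tarver2016

end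

-- WHAT THIS IS NOT: not a statement about the Navier–Stokes problem itself; not about any author beyond
-- the typed locator.
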